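import Mathlib.RingTheory.Nullstellensatz
import Literature.NumberTheory.Automorphic.LinearAlgebraicGroups
import HarnessLib

/-!
# The identity component of an algebraic subgroup of `GL n k` (trunk T-AUTOMORPHIC, G25 AutomorphicL)

Companion to `LinearAlgebraicGroups.lean` (namespace `Literature.Automorphic`), in the same concrete
vocabulary: an algebraic group is a subgroup `H ≤ GL n k` which is the zero locus of polynomials in
the matrix entries and `det⁻¹` (`IsAlgebraicSubgroup`), and "connected" means "no proper algebraic
subgroup of finite index" (`IsZConnected`). Springer, *Linear Algebraic Groups*, 2nd ed., 2.2.1: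
the identity component `H°` of a linear algebraic group `H` is a closed normal subgroup of finite
index, and every closed subgroup of finite index contains `H°`. Accordingly we *define*

* `identityComponent H = H ⊓ ⨅ {K ≤ H | K algebraic, (H : K) < ∞}`,

the intersection of all algebraic subgroups of finite index of `H` (meet with `H` so that
`identityComponent H ≤ H` holds unconditionally; for `H` algebraic, `H` itself is one of the `K`).
This is the notion needed to form the singular subtori `(Ker α)°` of a maximal torus and the
centralisers `G_α = Z_G((Ker α)°)` of Springer 7.1.3, 8.1.1.

Proved API (no named facts):

* `mem_vanishingIdeal_glCoordFun_iff`, `zeroLocusGL_vanishingIdeal` (an algebraic subset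
  `Z ⊆ GL n k` is the zero locus of its vanishing ideal — Mathlib's
  `MvPolynomial.vanishingIdeal k (glCoordFun '' Z)`, as in `Sweep2.IsDefinedOver`),
  `IsAlgebraicSubgroup.inf`, `isAlgebraicSubgroup_sInf` (intersections of algebraic subgroups are
  algebraic);
* `identityComponent_le`, `identityComponent_le_of_finiteIndex` (every algebraic subgroup of finite
  index contains `H°`), `isAlgebraicSubgroup_identityComponent`;
* `finiteIndex_identityComponent`: **`H°` has finite index in `H`** (Springer 2.2.1 (i)). In the
  points-over-`k` setting this is the Noetherian argument: `k[x_{ij}, det⁻¹]` is Noetherian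
  (`MvPolynomial.isNoetherianRing`), so among the vanishing ideals of the finite intersections
  `H ⊓ K₁ ⊓ ⋯ ⊓ K_m` of algebraic finite-index subgroups there is a maximal one, and the corresponding
  finite intersection is already contained in every `K`; hence `H°` is a finite intersection of
  finite-index subgroups;
* `isZConnected_identityComponent` (`H°` is Zariski-connected, 2.2.1 (i)),
  `IsZConnected.identityComponent_eq` (`H° = H` for connected `H`),
  `isTorusSubgroup_identityComponent` (the identity component of an algebraic subgroup of a torus is
  a torus: it is connected, commutative and consists of semisimple elements; Springer 3.2.7 (ii),
  6.3.2 (ii)).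

As in `LinearAlgebraicGroups.lean`, this `k`-points vocabulary is the textbook notion only for `k`
algebraically closed (faithfulness caveat there); the results of this file hold over any field.

## References

* T. A. Springer, *Linear Algebraic Groups*, 2nd ed., Progress in Mathematics 9, Birkhäuser (1998),
  1.1.2, 2.2.1, 3.2.7, 7.1.3.
-/

namespace Literature.NumberTheory.Automorphic

variable {k : Type*} [Field k] {n : Type*} [Fintype n] [DecidableEq n]

/-! ### Vanishing ideals and intersections of algebraic subgroups -/

section Vanishing

/-- The ideal `𝓘(Z)` of polynomials in the coordinates `x i j, det⁻¹` vanishing on a subset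
`Z ⊆ GL n k` is Mathlib's `MvPolynomial.vanishingIdeal k (glCoordFun '' Z)` (Springer 1.1.2); this
is its membership criterion in terms of `MvPolynomial.eval` and `glCoordFun`. [folklore] -/
lemma mem_vanishingIdeal_glCoordFun_iff {Z : Set (GL n k)} {p : MvPolynomial (GLCoord n) k} :
    p ∈ MvPolynomial.vanishingIdeal k (glCoordFun '' Z) ↔
      ∀ g ∈ Z, MvPolynomial.eval (glCoordFun g) p = 0 := by
  simp only [MvPolynomial.mem_vanishingIdeal_iff, Set.forall_mem_image]
  rfl

/-- The zero locus is antitone (Springer 1.1.2). [folklore] -/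
lemma zeroLocusGL_antitone {S S' : Set (MvPolynomial (GLCoord n) k)} (h : S ⊆ S') :
    zeroLocusGL S' ⊆ zeroLocusGL (k := k) (n := n) S := fun _ hg p hp => hg p (h hp)

/-- An algebraic subset of `GL n k` is the zero locus of its vanishing ideal (Springer 1.1.2:
`𝓥(𝓘(Z)) = Z` for closed `Z`). [folklore] -/
theorem zeroLocusGL_vanishingIdeal {Z : Set (GL n k)} {S : Set (MvPolynomial (GLCoord n) k)}
    (hZ : Z = zeroLocusGL S) :
    zeroLocusGL (MvPolynomial.vanishingIdeal k (glCoordFun '' Z) :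
      Set (MvPolynomial (GLCoord n) k)) = Z := by
  refine Set.Subset.antisymm ?_ fun g hg p hp => mem_vanishingIdeal_glCoordFun_iff.1 hp g hg
  subst hZ
  have hS : S ⊆ (MvPolynomial.vanishingIdeal k (glCoordFun '' zeroLocusGL S) :
      Set (MvPolynomial (GLCoord n) k)) :=
    fun p hp => mem_vanishingIdeal_glCoordFun_iff.2 fun g hg => hg p hp
  exact zeroLocusGL_antitone hS

/-- Two algebraic subsets of `GL n k` with the same vanishing ideal are equal. [folklore] -/
theorem eq_of_vanishingIdeal_eq {Z Z' : Set (GL n k)} {S S' : Set (MvPolynomial (GLCoord n) k)}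
    (hZ : Z = zeroLocusGL S) (hZ' : Z' = zeroLocusGL S')
    (h : MvPolynomial.vanishingIdeal k (glCoordFun '' Z) =
      MvPolynomial.vanishingIdeal k (glCoordFun '' Z')) : Z = Z' := by
  rw [← zeroLocusGL_vanishingIdeal hZ, ← zeroLocusGL_vanishingIdeal hZ', h]

/-- The zero locus of a union is the intersection of the zero loci. [folklore] -/
lemma zeroLocusGL_union (S S' : Set (MvPolynomial (GLCoord n) k)) :
    zeroLocusGL (k := k) (n := n) (S ∪ S') = zeroLocusGL S ∩ zeroLocusGL S' := by
  ext g
  simp only [zeroLocusGL, Set.mem_setOf_eq, Set.mem_union, Set.mem_inter_iff]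
  exact ⟨fun h => ⟨fun p hp => h p (Or.inl hp), fun p hp => h p (Or.inr hp)⟩,
    fun h p hp => hp.elim (h.1 p) (h.2 p)⟩

/-- The zero locus of a union of a family is the intersection of the zero loci. [folklore] -/
lemma zeroLocusGL_iUnion {ι : Sort*} (S : ι → Set (MvPolynomial (GLCoord n) k)) :
    zeroLocusGL (k := k) (n := n) (⋃ i, S i) = ⋂ i, zeroLocusGL (S i) := by
  ext g
  simp only [zeroLocusGL, Set.mem_setOf_eq, Set.mem_iUnion, Set.mem_iInter, forall_exists_index]
  exact ⟨fun h i p hp => h p i hp, fun h p i hp => h i p hp⟩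

/-- The intersection of two algebraic subgroups is algebraic (Springer 1.1.2). [folklore] -/
theorem IsAlgebraicSubgroup.inf {H K : Subgroup (GL n k)} (hH : IsAlgebraicSubgroup H)
    (hK : IsAlgebraicSubgroup K) : IsAlgebraicSubgroup (H ⊓ K) := by
  obtain ⟨S, hS⟩ := hH
  obtain ⟨S', hS'⟩ := hK
  exact ⟨S ∪ S', by rw [Subgroup.coe_inf, hS, hS', zeroLocusGL_union]⟩

/-- The intersection of any set of algebraic subgroups is algebraic (Springer 1.1.2; the empty
intersection is `⊤ = GL n k`). [folklore] -/
theorem isAlgebraicSubgroup_sInf {𝓗 : Set (Subgroup (GL n k))}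
    (h : ∀ H ∈ 𝓗, IsAlgebraicSubgroup H) : IsAlgebraicSubgroup (sInf 𝓗) := by
  choose S hS using h
  refine ⟨⋃ H : ↥𝓗, S H.1 H.2, ?_⟩
  rw [zeroLocusGL_iUnion, Subgroup.coe_sInf]
  ext g
  simp only [Set.mem_iInter, SetLike.mem_coe, Subtype.forall]
  refine forall₂_congr fun H hH => ?_
  rw [← SetLike.mem_coe, hS H hH]

end Vanishing

/-! ### The identity component -/

section IdentityComponent

variable (H : Subgroup (GL n k))

/-- The set of algebraic subgroups of `H` of finite index in `H` (Springer 2.2.1). [folklore] -/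
def finiteIndexAlgSubgroups : Set (Subgroup (GL n k)) :=
  {K | K ≤ H ∧ IsAlgebraicSubgroup K ∧ (K.subgroupOf H).FiniteIndex}

/-- The *identity component* `H°` of a subgroup `H ≤ GL n k`: the intersection (with `H`) of all
algebraic subgroups of `H` of finite index in `H`. For an algebraic `H` this is an algebraic
subgroup of finite index (`finiteIndex_identityComponent`), contained in every algebraic subgroup
of finite index, and Zariski-connected (`isZConnected_identityComponent`): Springer 2.2.1, where
`H°` is introduced as the irreducible component of `H` through `e` and these properties are
proved; over an algebraically closed field the two descriptions agree (2.2.1 (i), (iii)). For a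
non-algebraic `H` the value is a harmless junk value `≤ H`. [cite: SpringerLAG1998, 2.2.1] -/
def identityComponent : Subgroup (GL n k) :=
  H ⊓ sInf (finiteIndexAlgSubgroups H)

/-- `H° ≤ H`. [folklore] -/
theorem identityComponent_le : identityComponent H ≤ H := inf_le_left

variable {H}

/-- Membership in the set of algebraic finite-index subgroups. [folklore] -/
@[simp] lemma mem_finiteIndexAlgSubgroups_iff {K : Subgroup (GL n k)} :
    K ∈ finiteIndexAlgSubgroups H ↔
      K ≤ H ∧ IsAlgebraicSubgroup K ∧ (K.subgroupOf H).FiniteIndex := Iff.rfl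

/-- An algebraic subgroup belongs to its own set of algebraic finite-index subgroups. [folklore] -/
lemma self_mem_finiteIndexAlgSubgroups (hH : IsAlgebraicSubgroup H) :
    H ∈ finiteIndexAlgSubgroups H := by
  refine ⟨le_rfl, hH, ?_⟩
  rw [Subgroup.subgroupOf_self]
  infer_instance

/-- Every algebraic subgroup of finite index of `H` contains the identity component
(Springer 2.2.1 (iii)). [cite: SpringerLAG1998, 2.2.1 (iii)] -/
theorem identityComponent_le_of_finiteIndex {K : Subgroup (GL n k)} (hKH : K ≤ H)
    (hK : IsAlgebraicSubgroup K) (hfi : (K.subgroupOf H).FiniteIndex) : identityComponent H ≤ K :=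
  inf_le_right.trans (sInf_le ⟨hKH, hK, hfi⟩)

/-- Membership in the identity component. [folklore] -/
lemma mem_identityComponent_iff {g : GL n k} :
    g ∈ identityComponent H ↔ g ∈ H ∧ ∀ K ∈ finiteIndexAlgSubgroups H, g ∈ K := by
  rw [identityComponent, Subgroup.mem_inf, Subgroup.mem_sInf]

/-- The identity component of an algebraic subgroup is algebraic (Springer 2.2.1 (i): `H°` is
closed). [cite: SpringerLAG1998, 2.2.1 (i)] -/
theorem isAlgebraicSubgroup_identityComponent (hH : IsAlgebraicSubgroup H) :
    IsAlgebraicSubgroup (identityComponent H) := by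
  have h : identityComponent H = sInf (insert H (finiteIndexAlgSubgroups H)) := by
    rw [sInf_insert]; rfl
  rw [h]
  exact isAlgebraicSubgroup_sInf fun K hK => by
    rcases Set.mem_insert_iff.1 hK with rfl | hK
    exacts [hH, hK.2.1]

/-- The finite intersections `H ⊓ K₁ ⊓ ⋯ ⊓ K_m` of algebraic finite-index subgroups of an
algebraic `H` are again algebraic of finite index. [folklore] -/
lemma inf_finsetInf_mem_finiteIndexAlgSubgroups (hH : IsAlgebraicSubgroup H)
    {F : Finset (Subgroup (GL n k))} (hF : ↑F ⊆ finiteIndexAlgSubgroups H) :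
    H ⊓ F.inf id ∈ finiteIndexAlgSubgroups H := by
  classical
  induction F using Finset.induction_on with
  | empty => simpa using self_mem_finiteIndexAlgSubgroups hH
  | insert K F hKF ih =>
    rw [Finset.coe_insert, Set.insert_subset_iff] at hF
    obtain ⟨-, hKalg, hKfi⟩ := hF.1
    obtain ⟨-, halg, hfi⟩ := ih hF.2
    have hEq : H ⊓ (insert K F).inf id = K ⊓ (H ⊓ F.inf id) := by
      rw [Finset.inf_insert, id, inf_left_comm]
    refine ⟨inf_le_left, ?_, ?_⟩
    · rw [hEq]
      exact hKalg.inf halg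
    · have : ((H ⊓ (insert K F).inf id).subgroupOf H) =
          K.subgroupOf H ⊓ (H ⊓ F.inf id).subgroupOf H := by
        rw [hEq]
        exact Subgroup.comap_inf K (H ⊓ F.inf id) H.subtype
      rw [this]
      infer_instance

/-- `H°` is a finite intersection `H ⊓ K₁ ⊓ ⋯ ⊓ K_m` of algebraic finite-index subgroups of the
algebraic `H ≤ GL n k` — the one whose vanishing ideal is maximal, which exists because
`k[x_{ij}, det⁻¹]` is Noetherian (the Noetherian argument behind Springer 2.2.1 (i); the
finite-index statement itself is `finiteIndex_identityComponent`). [cite: SpringerLAG1998, 2.2.1 (i)] -/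
theorem exists_identityComponent_eq_inf_finsetInf (hH : IsAlgebraicSubgroup H) :
    ∃ F : Finset (Subgroup (GL n k)), ↑F ⊆ finiteIndexAlgSubgroups H ∧
      identityComponent H = H ⊓ F.inf id := by
  classical
  -- the vanishing ideals of the finite intersections
  set A : Set (Ideal (MvPolynomial (GLCoord n) k)) :=
    {I | ∃ F : Finset (Subgroup (GL n k)), ↑F ⊆ finiteIndexAlgSubgroups H ∧
      I = MvPolynomial.vanishingIdeal k
        (glCoordFun '' ((H ⊓ F.inf id : Subgroup (GL n k)) : Set (GL n k)))} with hA
  have hAne : A.Nonempty := ⟨_, ∅, by simp, rfl⟩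
  obtain ⟨M, ⟨F₀, hF₀, rfl⟩, hmax⟩ :=
    set_has_maximal_iff_noetherian.2 (inferInstance : IsNoetherianRing (MvPolynomial (GLCoord n) k))
      A hAne
  refine ⟨F₀, hF₀, le_antisymm ?_ ?_⟩
  · -- `H° ≤ H ⊓ ⨅ F₀`
    refine le_inf (identityComponent_le H) (Finset.le_inf fun K hK => ?_)
    obtain ⟨hKH, hKalg, hKfi⟩ := hF₀ hK
    exact identityComponent_le_of_finiteIndex hKH hKalg hKfi
  · -- `H ⊓ ⨅ F₀ ≤ K` for every algebraic finite-index `K`, by maximality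
    refine le_inf inf_le_left (le_sInf fun K hK => ?_)
    have hins : ↑(insert K F₀) ⊆ finiteIndexAlgSubgroups H := by
      rw [Finset.coe_insert]
      exact Set.insert_subset hK hF₀
    have hle : H ⊓ (insert K F₀).inf id ≤ H ⊓ F₀.inf id := by
      rw [Finset.inf_insert, id]
      exact inf_le_inf_left _ inf_le_right
    have hI : MvPolynomial.vanishingIdeal k
          (glCoordFun '' ((H ⊓ F₀.inf id : Subgroup (GL n k)) : Set (GL n k))) ≤
        MvPolynomial.vanishingIdeal k
          (glCoordFun '' ((H ⊓ (insert K F₀).inf id : Subgroup (GL n k)) : Set (GL n k))) :=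
      MvPolynomial.vanishingIdeal_anti_mono (Set.image_mono (SetLike.coe_subset_coe.2 hle))
    have hmemA : MvPolynomial.vanishingIdeal k
        (glCoordFun '' ((H ⊓ (insert K F₀).inf id : Subgroup (GL n k)) : Set (GL n k))) ∈ A :=
      ⟨_, hins, rfl⟩
    have hEq := eq_of_le_of_not_lt hI (hmax _ hmemA)
    obtain ⟨S₀, hS₀⟩ := (inf_finsetInf_mem_finiteIndexAlgSubgroups hH hF₀).2.1
    obtain ⟨S₁, hS₁⟩ := (inf_finsetInf_mem_finiteIndexAlgSubgroups hH hins).2.1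
    have hsets := eq_of_vanishingIdeal_eq hS₀ hS₁ hEq
    have hle' : H ⊓ F₀.inf id ≤ H ⊓ (insert K F₀).inf id := SetLike.coe_subset_coe.1 hsets.le
    rw [Finset.inf_insert, id] at hle'
    exact hle'.trans (inf_le_right.trans inf_le_left)

/-- The identity component of an algebraic subgroup is an algebraic subgroup of finite index
(Springer 2.2.1 (i)). [cite: SpringerLAG1998, 2.2.1 (i)] -/
theorem identityComponent_mem_finiteIndexAlgSubgroups (hH : IsAlgebraicSubgroup H) :
    identityComponent H ∈ finiteIndexAlgSubgroups H := by
  obtain ⟨F, hF, hEq⟩ := exists_identityComponent_eq_inf_finsetInf hH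
  rw [hEq]
  exact inf_finsetInf_mem_finiteIndexAlgSubgroups hH hF

/-- **Springer 2.2.1 (i): the identity component has finite index.** [cite: SpringerLAG1998, 2.2.1 (i)] -/
theorem finiteIndex_identityComponent (hH : IsAlgebraicSubgroup H) :
    ((identityComponent H).subgroupOf H).FiniteIndex :=
  (identityComponent_mem_finiteIndexAlgSubgroups hH).2.2

/-- **Springer 2.2.1 (i): the identity component is connected**, i.e. it has no proper
algebraic subgroup of finite index: such a subgroup has finite index in `H`, hence contains `H°`.
[cite: SpringerLAG1998, 2.2.1 (i)] -/
theorem isZConnected_identityComponent (hH : IsAlgebraicSubgroup H) :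
    IsZConnected (identityComponent H) := by
  refine ⟨isAlgebraicSubgroup_identityComponent hH, fun K hK hKalg hKfi => le_antisymm hK ?_⟩
  refine identityComponent_le_of_finiteIndex (hK.trans (identityComponent_le H)) hKalg ⟨?_⟩
  have h1 : K.relIndex (identityComponent H) ≠ 0 := hKfi.index_ne_zero
  have h2 : (identityComponent H).relIndex H ≠ 0 := (finiteIndex_identityComponent hH).index_ne_zero
  have h := Subgroup.relIndex_mul_relIndex K (identityComponent H) H hK (identityComponent_le H)
  change K.relIndex H ≠ 0
  rw [← h]
  exact mul_ne_zero h1 h2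

/-- A Zariski-connected subgroup is its own identity component (Springer 2.2.1).
[cite: SpringerLAG1998, 2.2.1] -/
theorem IsZConnected.identityComponent_eq (hH : IsZConnected H) : identityComponent H = H :=
  hH.2 _ (identityComponent_le H) (isAlgebraicSubgroup_identityComponent hH.1)
    (finiteIndex_identityComponent hH.1)

/-- An algebraic subgroup of finite index of `H` has the same identity component as `H`
(Springer 2.2.1 (iii)). [cite: SpringerLAG1998, 2.2.1 (iii)] -/
theorem identityComponent_eq_of_finiteIndex {K : Subgroup (GL n k)} (hH : IsAlgebraicSubgroup H)
    (hKH : K ≤ H) (hK : IsAlgebraicSubgroup K) (hfi : (K.subgroupOf H).FiniteIndex) :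
    identityComponent K = identityComponent H := by
  refine le_antisymm ?_ ?_
  · -- `H°` is an algebraic subgroup of finite index of `K`
    refine identityComponent_le_of_finiteIndex (identityComponent_le_of_finiteIndex hKH hK hfi)
      (isAlgebraicSubgroup_identityComponent hH) ⟨?_⟩
    have h := Subgroup.relIndex_mul_relIndex (identityComponent H) K H
      (identityComponent_le_of_finiteIndex hKH hK hfi) hKH
    have hne : (identityComponent H).relIndex H ≠ 0 :=
      (finiteIndex_identityComponent hH).index_ne_zero
    rw [← h] at hne
    exact left_ne_zero_of_mul hne
  · refine le_inf (identityComponent_le_of_finiteIndex hKH hK hfi) (le_sInf fun L hL => ?_)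
    obtain ⟨hLK, hLalg, hLfi⟩ := hL
    refine identityComponent_le_of_finiteIndex (hLK.trans hKH) hLalg ⟨?_⟩
    have h := Subgroup.relIndex_mul_relIndex L K H hLK hKH
    change L.relIndex H ≠ 0
    rw [← h]
    exact mul_ne_zero hLfi.index_ne_zero hfi.index_ne_zero

/-- The identity component of an algebraic subgroup of a torus is a torus: it is
Zariski-connected, commutative and consists of semisimple elements (Springer 3.2.7 (ii) with
6.3.2: a closed connected subgroup of a torus is a torus). In particular the singular subtori
`(Ker α)°` of a maximal torus (Springer 7.1.3) are tori. [cite: SpringerLAG1998, 3.2.7 (ii)] -/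
theorem isTorusSubgroup_identityComponent {T K : Subgroup (GL n k)} (hT : IsTorusSubgroup T)
    (hK : IsAlgebraicSubgroup K) (hKT : K ≤ T) : IsTorusSubgroup (identityComponent K) := by
  have hle : identityComponent K ≤ T := (identityComponent_le K).trans hKT
  obtain ⟨-, hcomm, hss⟩ := hT
  refine ⟨isZConnected_identityComponent hK, ⟨⟨fun a b => Subtype.ext ?_⟩⟩, fun t ht => hss t (hle ht)⟩
  have h := congrArg Subtype.val (hcomm.is_comm.comm (⟨a.1, hle a.2⟩ : ↥T) ⟨b.1, hle b.2⟩)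
  simpa using h

/-! ### Conjugates of algebraic subgroups; normality of the identity component -/

/-- The polynomials expressing the coordinates of `h * g` in terms of those of `g`, for a fixed
`h ∈ GL n k` (Springer 2.1.2: left translations are morphisms). [folklore] -/
noncomputable def leftMulPolyGL (h : GL n k) (c : GLCoord n) : MvPolynomial (GLCoord n) k :=
  MvPolynomial.bind₁ (Sum.elim (fun d => MvPolynomial.C (glCoordFun h d)) MvPolynomial.X)
    (mulPolyGL c)

/-- `leftMulPolyGL h` computes the coordinates of `h * g`. [folklore] -/
lemma eval_leftMulPolyGL (h g : GL n k) (c : GLCoord n) :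
    MvPolynomial.eval (glCoordFun g) (leftMulPolyGL h c) = glCoordFun (h * g) c := by
  rw [leftMulPolyGL, eval_bind₁, ← eval_mulPolyGL]
  congr 2
  funext i
  rcases i with d | d <;> simp

/-- The polynomials expressing the coordinates of `h * g * h'` in terms of those of `g`, for fixed
`h, h' ∈ GL n k` (Springer 2.1.2). [folklore] -/
noncomputable def conjPolyGL (h h' : GL n k) (c : GLCoord n) : MvPolynomial (GLCoord n) k :=
  MvPolynomial.bind₁ (Sum.elim (leftMulPolyGL h) (fun d => MvPolynomial.C (glCoordFun h' d)))
    (mulPolyGL c)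

/-- `conjPolyGL h h'` computes the coordinates of `h * g * h'`. [folklore] -/
lemma eval_conjPolyGL (h h' g : GL n k) (c : GLCoord n) :
    MvPolynomial.eval (glCoordFun g) (conjPolyGL h h' c) = glCoordFun (h * g * h') c := by
  rw [conjPolyGL, eval_bind₁, ← eval_mulPolyGL]
  congr 2
  funext i
  rcases i with d | d <;> simp [eval_leftMulPolyGL]

/-- A conjugate of an algebraic subgroup of `GL n k` is algebraic (Springer 2.1.2: inner
automorphisms are automorphisms of algebraic groups). [folklore] -/
theorem IsAlgebraicSubgroup.map_conj {K : Subgroup (GL n k)} (hK : IsAlgebraicSubgroup K)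
    (h : GL n k) : IsAlgebraicSubgroup (K.map (MulAut.conj h).toMonoidHom) := by
  obtain ⟨S, hS⟩ := hK
  refine ⟨MvPolynomial.bind₁ (conjPolyGL h⁻¹ h) '' S, Set.ext fun g => ?_⟩
  have hev : ∀ p : MvPolynomial (GLCoord n) k,
      MvPolynomial.eval (glCoordFun g) (MvPolynomial.bind₁ (conjPolyGL h⁻¹ h) p) =
        MvPolynomial.eval (glCoordFun (h⁻¹ * g * h)) p := fun p => by
    rw [eval_bind₁]
    exact congrArg (fun f => MvPolynomial.eval f p) (funext (eval_conjPolyGL h⁻¹ h g))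
  simp only [SetLike.mem_coe, Subgroup.mem_map_equiv, MulAut.conj_symm_apply, zeroLocusGL,
    Set.mem_setOf_eq, Set.forall_mem_image, hev]
  rw [← SetLike.mem_coe, hS]
  rfl

/-- Conjugation by an element of `H` permutes the algebraic finite-index subgroups of `H`. [folklore] -/
lemma map_conj_mem_finiteIndexAlgSubgroups {K : Subgroup (GL n k)}
    (hK : K ∈ finiteIndexAlgSubgroups H) {h : GL n k} (hh : h ∈ H) :
    K.map (MulAut.conj h).toMonoidHom ∈ finiteIndexAlgSubgroups H := by
  obtain ⟨hKH, hKalg, hKfi⟩ := hK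
  have hHH : H.map (MulAut.conj h).toMonoidHom = H :=
    Subgroup.mem_normalizer_iff_map_conj_eq.1 (Subgroup.le_normalizer hh)
  refine ⟨?_, hKalg.map_conj h, ⟨?_⟩⟩
  · conv_rhs => rw [← hHH]
    exact Subgroup.map_mono hKH
  · have := Subgroup.relIndex_map_map_of_injective (f := (MulAut.conj h).toMonoidHom) K H
      (MulAut.conj h).injective
    rw [hHH] at this
    change (K.map (MulAut.conj h).toMonoidHom).relIndex H ≠ 0
    rw [this]
    exact hKfi.index_ne_zero

/-- **Springer 2.2.1 (i): the identity component is a normal subgroup.**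
[cite: SpringerLAG1998, 2.2.1 (i)] -/
theorem normal_identityComponent : ((identityComponent H).subgroupOf H).Normal := by
  refine ⟨fun x hx h => ?_⟩
  rw [Subgroup.mem_subgroupOf] at hx ⊢
  simp only [Subgroup.coe_mul, Subgroup.coe_inv]
  rw [mem_identityComponent_iff] at hx ⊢
  refine ⟨H.mul_mem (H.mul_mem h.2 hx.1) (H.inv_mem h.2), fun K hK => ?_⟩
  have hx' := hx.2 _ (map_conj_mem_finiteIndexAlgSubgroups hK (H.inv_mem h.2))
  rw [Subgroup.mem_map_equiv, MulAut.conj_symm_apply, inv_inv] at hx'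
  exact hx'

end IdentityComponent

end Literature.NumberTheory.Automorphic
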